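import Mathlib
import Summits.NavierStokesRegularity.NavierStokesRegularity.Theorems.SubOnsagerCeilingOrthantTailCeiling.Negative.OrthantTailCeilingFalseOfSideBranchCeilingEscape
import Summits.NavierStokesRegularity.NavierStokesRegularity.Theorems.SubOnsagerCeilingForwardTailCeilingTwinReduction
import HarnessLib

/-!
# `SubOnsagerCeiling.ForwardTailCeiling` (stmt-NavierStokesRegularity-26608) — negative lemma modulo the
# CEILING-ASSISTED ONE-DEPTH escape of the side-branch table (`SideBranchCeilingEscape`)

Composition of two kernel facts of the tree:

* `forwardTailCeiling_imp_ceilingAt_sideBranchTable` (`Theorems/SubOnsagerCeilingForwardTailCeilingTwinReduction.lean`):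
  the forward-source ceiling `ForwardTailCeiling` implies, at every scale ratio `ε₀ ∈ (0,1]`, the per-table
  body `CeilingAt 10 ε₀ sideBranchTable` of the aside crux `OrthantTailCeiling` on its witness table `α_SB`;
* `not_ceilingAt_sideBranch_of_ceilingEscape`
  (`Theorems/SubOnsagerCeilingOrthantTailCeiling/Negative/OrthantTailCeilingFalseOfSideBranchCeilingEscape.lean`):
  that body fails as soon as, for every candidate `(θ, C)`, ONE block `0..K` of `α_SB` loses more than the
  ceiling's own tail `C E₀ (1+ε₀)^{-2θ(K+1)}` by a viscosity-uniform time along the non-negative,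
  CEILING-OBEYING regular solutions (`SideBranchCeilingEscapeAt ε₀`; `Prop`, NOTHING asserted; implied by
  the Onsager-critical a priori estimate of record).

Hence **`ForwardTailCeiling_false_of_SideBranchCeilingEscape : SideBranchCeilingEscape → ¬ ForwardTailCeiling`**
(the crux BY NAME), superseding `ForwardTailCeiling_false_of_SideBranchCriticalEscapeEstimate`.  The
class-restricted restatement `ForwardTailCeilingKP` (diagonal feeds, item 27057) is NOT touched.

HONEST FRAMING: MODEL lattice ODEs only (Tao 2016 §4 vocabulary; rung TL-M2Break); a conditional
refutation; it settles nothing by itself and no summit is proved; nothing here is a statement about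
the Navier–Stokes equations. [cite: Tao2016AveragedNS, §4 (4.2)–(4.3), (4.5), (4.8)]
-/

noncomputable section

-- the sub-problem namespace `NavierStokesRegularity.NavierStokesRegularity` is the tree's layout (D-0017)
set_option linter.dupNamespace false

namespace Summit.NavierStokesRegularity.NavierStokesRegularity.Theorems.SubOnsagerCeiling

open Summit.NavierStokesRegularity.NavierStokesRegularity.Theses.SubOnsagerCeiling

/-- **`SideBranchCeilingEscapeAt ε₀ → ¬ ForwardTailCeiling`** for any `ε₀ ∈ (0,1]`: the forward-source
ceiling (item 26608) would give `CeilingAt 10 ε₀ sideBranchTable` (twin reduction of record,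
`forwardTailCeiling_imp_ceilingAt_sideBranchTable`), which the ceiling-assisted escape refutes.
MODEL lattice only; conditional. [this file] -/
theorem forwardTailCeiling_false_of_sideBranchCeilingEscapeAt {ε₀ : ℝ} (hε : 0 < ε₀) (hε1 : ε₀ ≤ 1)
    (hH : SideBranchCeilingEscapeAt ε₀) : ¬ ForwardTailCeiling := fun h =>
  not_ceilingAt_sideBranch_of_ceilingEscape hε hH (forwardTailCeiling_imp_ceilingAt_sideBranchTable h hε hε1)

/-- **Negative lemma (conditional refutation of the forward crux BY NAME, ceiling-assisted form).**
`SideBranchCeilingEscape → ¬ ForwardTailCeiling`.  MODEL lattice only; conditional; settles nothing by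
itself. [this file] -/
theorem forwardTailCeiling_false_of_sideBranchCeilingEscape (hH : SideBranchCeilingEscape) :
    ¬ ForwardTailCeiling := by
  obtain ⟨ε₀, hε, hε1, hHε⟩ := hH
  exact forwardTailCeiling_false_of_sideBranchCeilingEscapeAt hε hε1 hHε

/-- Gate-shaped alias (`<Decl>_false_of_<H>`): `SideBranchCeilingEscape → ¬ ForwardTailCeiling`.
MODEL lattice only; conditional; settles nothing by itself. [this file] -/
theorem ForwardTailCeiling_false_of_SideBranchCeilingEscape :
    SideBranchCeilingEscape → ¬ ForwardTailCeiling :=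
  forwardTailCeiling_false_of_sideBranchCeilingEscape

end Summit.NavierStokesRegularity.NavierStokesRegularity.Theorems.SubOnsagerCeiling

end
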